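import Literature.NumberTheory.GaloisRepresentations.LocalEulerPoincareCharacteristic
import Literature.NumberTheory.GaloisRepresentations.LocalDualityTwoZero
import Literature.NumberTheory.GaloisRepresentations.CyclicIndexEulerChar
import Literature.NumberTheory.GaloisRepresentations.GaloisRepUnramifiedProofs
import Literature.NumberTheory.EllipticCurves.LocalTateDualityOrderForE
import Literature.NumberTheory.EllipticCurves.LocalTorsionInvariants
import Literature.NumberTheory.EllipticCurves.WeilPairingProofs
import Literature.NumberTheory.EllipticCurves.KummerSelmerStructure
import Literature.NumberTheory.EllipticCurves.LocalPointsIntegersSubgroup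
import Literature.NumberTheory.Automorphic.AdicCompletionLocalField
import HarnessLib

/-!
# `#H¹(K_v, E[n]) = (#E(K_v)[n] · #(𝓞_v/n))²` from Tate's local Euler–Poincaré characteristic

Topic `NumberTheory/EllipticCurves`; namespace `Literature.NumberTheory.EllipticCurves` (as
`LocalTateDualityOrderForE.lean`, whose hypothesis `hEuler` this file supplies). Theorems only:
**no named fact is introduced** (D-0026); the one arithmetic input is the tree's named fact
`Literature.NumberTheory.GaloisRepresentations.localEulerPoincareCharacteristic K_v` (Milne, *ADT*,
I Thm. 2.8: `#H⁰ · #H² · (𝓞 : m𝓞) = #H¹` for a finite module of order `m` over a non-archimedean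
local field of characteristic `0`), taken as a hypothesis.

Let `K` be a number field, `E = W` an elliptic curve over `K`, `v` a finite place, `K_v =
v.adicCompletion K` (a non-archimedean local field of characteristic `0`: the tree's instance
`instIsNonarchimedeanLocalFieldAdicCompletion`), `𝓞_v = v.adicCompletionIntegers K`, and `n` a
prime power.  For `M = E[n]` (`#M = n²`, Silverman *AEC* III.6.4):

* `#H⁰(K_v, E[n]) = #E(K_v)[n]` (`natCard_invariants_torsion_restrictField`; the tree's
  `natCard_galoisCohomology_zero_torsion_restrictField_nat`, Milne I §3);
* `#H²(K_v, E[n]) = #E(K_v)[n]` (`natCard_galoisCohomology_two_torsion_restrictField`): the tree's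
  PROVED local duality in bidegree `(2,0)` `natCard_two_eq_natCard_invariants_homRep`
  (`#H²(F, M) = #Hom_{Γ_F}(M, μ_n)`, Milne I Cor. 2.3) and the Weil pairing `E[n] ≅ Hom(E[n], μ_n)`
  as `Γ_{K_v}`-modules (`weilDualLocalIso`, `exists_weilPairing_holds`, AEC III.8.1);
* `(𝓞_v : n²𝓞_v) = #(𝓞_v/n)²`, the valuation ring `𝒪[K_v]` of the local-field structure being the
  ring of `v`-adic integers (`adicCompletion_valuation_le_one_iff`);

hence (`natCard_galoisCohomology_one_torsion_adicCompletion_eq_sq`)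

  **`#H¹(K_v, E[n]) = (#E(K_v)[n] · #(𝓞_v/n))²`** — Milne I Thm. 2.8 for `M = E[n]`,

which is EXACTLY the hypothesis `hEuler` of `LocalTateDualityOrderForE.lean` and
`CasselsTateLemma615LocalInputs.lean`. Consequences recorded (for prime-power `n`, from the fact
alone): the order statement of Tate local duality for `E`, `#H¹(K_v, E)[n] = #(E(K_v)/nE(K_v))`
(Milne I Thm. 3.2 / Cor. 3.4), and the maximal isotropy `𝓛_v^⊥ = 𝓛_v` of the local Kummer
condition for the local Weil cup product (Milne I Cor. 3.4 / Lemma 6.15; Poonen–Rains Prop. 4.10).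
Also the fact restated at `K_v` with `𝓞_v` in place of `𝒪[K_v]`
(`localEulerPoincareCharacteristic_adicCompletion`).

Motivation: cell `b2b-bsdres` (X11b, routes R1/p2): the `≤` half of Jetchev–Skinner–Wan 2017
Prop. 3.2.1 (the Selmer cardinality input of Castella 2018 Thm. 2.3) needs `𝓛_𝔭̄^⊥ = 𝓛_𝔭̄` and
`#H¹(K_𝔭̄, E[p^k]) = #𝓛_𝔭̄²`; provefact `WeierstrassCurve.exists_casselsTate_pairing` (its
`hEuler`).

## References

* [MilneADT2006] J. S. Milne, *Arithmetic Duality Theorems*, 2nd ed. (2006), Ch. I: Cor. 2.3,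
  Thm. 2.8 (p. 31), Thm. 3.2, Lemma 3.3, Cor. 3.4, Lemma 6.15.
* [SilvermanAEC2009] J. H. Silverman, *The Arithmetic of Elliptic Curves*, 2nd ed. (2009),
  III.6.4, Prop. III.8.1.
* [PoonenRains2012] B. Poonen, E. Rains, JAMS 25 (2012), Prop. 4.10.
-/

noncomputable section

open scoped Classical

open CategoryTheory Function
open Field IsNonarchimedeanLocalField ValuativeRel

universe u

namespace Literature.NumberTheory.EllipticCurves

open _root_.WeierstrassCurve Field Function NumberField IsDedekindDomain
open Literature.NumberTheory.GaloisRepresentations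
open Literature.NumberTheory.GaloisRepresentations.DiscreteGaloisModule (mu MuCarrier)
open scoped ContRepresentation

/-! ## Quotients by principal ideals: multiplicativity of the index -/

section Quot

variable {R : Type*} [CommRing R] [IsDomain R]

/-- `#(R ⧸ (ab)) = #(R ⧸ (a)) · #(R ⧸ (b))` for `a ≠ 0` in a domain. [folklore] -/
private theorem natCard_quotient_span_singleton_mul {a : R} (ha : a ≠ 0) (b : R) :
    Nat.card (R ⧸ Ideal.span {a * b}) = Nat.card (R ⧸ Ideal.span {a}) * Nat.card (R ⧸ Ideal.span {b}) := by
  -- the projection `R/(ab) → R/(a)`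
  have hle : Ideal.span {a * b} ≤ Ideal.span {a} := Ideal.span_singleton_le_span_singleton.mpr ⟨b, rfl⟩
  let f : R ⧸ Ideal.span {a * b} →+* R ⧸ Ideal.span {a} := Ideal.Quotient.factor hle
  have hf : Surjective f := Ideal.Quotient.factor_surjective hle
  -- `x ↦ a x : R → R/(ab)` has kernel `(b)` and range `ker f`
  let g : R →+ R ⧸ Ideal.span {a * b} :=
    (Ideal.Quotient.mk (Ideal.span {a * b})).toAddMonoidHom.comp (AddMonoidHom.mulLeft a)
  have hgker : g.ker = (Ideal.span {b}).toAddSubgroup := by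
    ext x
    simp only [g, AddMonoidHom.mem_ker, AddMonoidHom.coe_comp, comp_apply, AddMonoidHom.coe_mulLeft,
      RingHom.toAddMonoidHom_eq_coe, AddMonoidHom.coe_coe, Ideal.Quotient.eq_zero_iff_mem,
      Ideal.mem_span_singleton, Submodule.mem_toAddSubgroup]
    constructor
    · rintro ⟨c, hc⟩
      exact ⟨c, mul_left_cancel₀ ha (by rw [hc, mul_assoc])⟩
    · rintro ⟨c, rfl⟩
      exact ⟨c, by rw [mul_assoc]⟩
  have hgrange : g.range = f.toAddMonoidHom.ker := by
    ext y
    constructor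
    · rintro ⟨x, rfl⟩
      simp only [g, f, RingHom.toAddMonoidHom_eq_coe, AddMonoidHom.mem_ker, AddMonoidHom.coe_comp,
        AddMonoidHom.coe_coe, comp_apply, AddMonoidHom.coe_mulLeft, Ideal.Quotient.factor_mk,
        Ideal.Quotient.eq_zero_iff_mem]
      exact Ideal.mem_span_singleton.mpr ⟨x, rfl⟩
    · intro hy
      obtain ⟨z, rfl⟩ := Ideal.Quotient.mk_surjective y
      simp only [f, RingHom.toAddMonoidHom_eq_coe, AddMonoidHom.mem_ker, AddMonoidHom.coe_coe,
        Ideal.Quotient.factor_mk, Ideal.Quotient.eq_zero_iff_mem, Ideal.mem_span_singleton] at hy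
      obtain ⟨c, rfl⟩ := hy
      exact ⟨c, rfl⟩
  -- count
  have h1 : Nat.card (R ⧸ Ideal.span {a * b}) =
      Nat.card ((R ⧸ Ideal.span {a * b}) ⧸ f.toAddMonoidHom.ker) * Nat.card f.toAddMonoidHom.ker :=
    AddSubgroup.card_eq_card_quotient_mul_card_addSubgroup _
  have h2 : Nat.card ((R ⧸ Ideal.span {a * b}) ⧸ f.toAddMonoidHom.ker) = Nat.card (R ⧸ Ideal.span {a}) :=
    Nat.card_congr (QuotientAddGroup.quotientKerEquivOfSurjective f.toAddMonoidHom hf).toEquiv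
  have h3 : Nat.card f.toAddMonoidHom.ker = Nat.card (R ⧸ Ideal.span {b}) := by
    rw [← hgrange]
    have e := QuotientAddGroup.quotientKerEquivRange g
    rw [← Nat.card_congr e.toEquiv, hgker]
    rfl
  rw [h1, h2, h3]

end Quot

/-! ## The valuation ring of the local field `K_v` is the ring of `v`-adic integers -/

section Integers

variable (K : Type u) [Field K] [NumberField K] (v : HeightOneSpectrum (𝓞 K))

/-- `𝒪[K_v]` (the valuation ring of the `ValuativeRel` structure of the local field `K_v`) IS the
ring of `v`-adic integers `𝓞_v` (same elements: `valuation K_v x ≤ 1 ↔ ‖x‖ ≤ 1`, tree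
`adicCompletion_valuation_le_one_iff`). [folklore] -/
private theorem valuation_integer_eq_adicCompletionIntegers :
    (valuation (v.adicCompletion K)).integer = (v.adicCompletionIntegers K).toSubring := by
  ext x
  rw [Valuation.mem_integer_iff, adicCompletion_valuation_le_one_iff K v x,
    ValuationSubring.mem_toSubring, HeightOneSpectrum.mem_adicCompletionIntegers,
    Valued.toNormedField.norm_le_one_iff]

/-- `#(𝒪[K_v] ⧸ m) = #(𝓞_v ⧸ m)` for every `m : ℕ` (transport along
`valuation_integer_eq_adicCompletionIntegers`). [folklore] -/
private theorem natCard_integer_quotient_natCast_eq (m : ℕ) :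
    Nat.card (𝒪[v.adicCompletion K] ⧸ Ideal.span {((m : ℕ) : 𝒪[v.adicCompletion K])}) =
      Nat.card (v.adicCompletionIntegers K ⧸ Ideal.span {((m : ℕ) : v.adicCompletionIntegers K)}) := by
  have hO := valuation_integer_eq_adicCompletionIntegers K v
  let e : 𝒪[v.adicCompletion K] ≃+* v.adicCompletionIntegers K := RingEquiv.subringCongr hO
  have hIJ : Ideal.span {((m : ℕ) : v.adicCompletionIntegers K)} =
      (Ideal.span {((m : ℕ) : 𝒪[v.adicCompletion K])}).map (e : 𝒪[v.adicCompletion K] →+* _) := by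
    rw [Ideal.map_span, Set.image_singleton, map_natCast]
  exact Nat.card_congr (Ideal.quotientEquiv _ _ e hIJ).toEquiv

end Integers

/-! ## The fact at `K_v`, with the ring of `v`-adic integers -/

section FactAtPlace

-- `H²` needs `LocallyCompactSpace Γ`; as in the tree's local-duality files, the compactness of absolute
-- Galois groups is a local instance only.
attribute [local instance] absoluteGaloisGroup_compactSpace

variable (K : Type u) [Field K] [NumberField K] (v : HeightOneSpectrum (𝓞 K))

/-- **Milne I Thm. 2.8 at the completion `K_v` of a number field, with `𝓞_v = v.adicCompletionIntegers K`**: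
for every finite discrete `Γ_{K_v}`-module `M`, `H¹(K_v, M)`, `H²(K_v, M)` are finite and
`#M^{Γ_{K_v}} · #H²(K_v, M) · #(𝓞_v ⧸ (#M)𝓞_v) = #H¹(K_v, M)` — the named fact
`localEulerPoincareCharacteristic (v.adicCompletion K)` with the valuation ring of the local field
identified with the `v`-adic integers. [cite: MilneADT2006, Ch. I §2, Thm. 2.8 (p. 31)] -/
theorem localEulerPoincareCharacteristic_adicCompletion
    (hEP : localEulerPoincareCharacteristic (v.adicCompletion K))
    {M : Type u} [AddCommGroup M] [TopologicalSpace M] [DiscreteTopology M] [Finite M]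
    (ρ : DiscreteGaloisModule (v.adicCompletion K) M) :
    Finite (galoisCohomology ρ 1) ∧ Finite (galoisCohomology ρ 2) ∧
      Nat.card ρ.toTopRep.ρ.invariants * Nat.card (galoisCohomology ρ 2) *
          Nat.card (v.adicCompletionIntegers K ⧸
            Ideal.span {((Nat.card M : ℕ) : v.adicCompletionIntegers K)}) =
        Nat.card (galoisCohomology ρ 1) := by
  rw [← natCard_integer_quotient_natCast_eq K v (Nat.card M)]
  exact hEP ρ

end FactAtPlace

/-! ## `#H¹(K_v, E[n]) = (#E(K_v)[n] · #(𝓞_v/n))²` from the local Euler–Poincaré characteristic -/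

section Torsion

-- Cup products / `H²` need `LocallyCompactSpace Γ_F`; as in the tree's local-duality files, the
-- compactness of absolute Galois groups is a local instance only.
attribute [local instance] absoluteGaloisGroup_compactSpace

variable {K : Type u} [Field K] [NumberField K] (W : WeierstrassCurve K) [W.IsElliptic]
variable (v : HeightOneSpectrum (𝓞 K))

attribute [local instance] finite_geomTorsion_of_neZero Literature.NumberTheory.EllipticCurves.finite_muCarrier

/-- `#H⁰(K_v, E[n])` as invariants: `#(E[n]|_{Γ_{K_v}})^{Γ_{K_v}} = #E(K_v)[n]` (Milne, *ADT*, I §3: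
`H⁰(K, A_n) = A(K)_n`; the tree's `natCard_galoisCohomology_zero_torsion_restrictField_nat` read on
the invariants through `galoisCohomologyZeroEquiv`). [cite: MilneADT2006, Ch. I §3, Lemma 3.3 (the term `A(K)_n`)] -/
theorem natCard_invariants_torsion_restrictField (F : Type u) [Field F] [Algebra K F] [CharZero F]
    {n : ℕ} (hn : n ≠ 0) :
    Nat.card (GaloisRep.restrictField F (W.torsionGaloisModule n)).toTopRep.ρ.invariants =
      Nat.card (nsmulAddMonoidHom n : (W.baseChange F).toAffine.Point →+ _).ker := by
  rw [← W.natCard_galoisCohomology_zero_torsion_restrictField_nat F hn]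
  exact (Nat.card_congr (galoisCohomologyZeroEquiv
    (GaloisRep.restrictField F (W.torsionGaloisModule n))).toEquiv).symm

/-- `#H²(K_v, E[n]) = #E(K_v)[n]` for `n` a prime power: local duality in bidegree `(2,0)`
(tree `natCard_two_eq_natCard_invariants_homRep`: `#H²(F, M) = #Hom_{Γ_F}(M, μ_n)`) and the Weil
pairing (`E[n] ≅ Hom(E[n], μ_n)` as `Γ_F`-modules, tree `weilDualLocalIso`).
[cite: MilneADT2006, Ch. I, Cor. 2.3] [cite: SilvermanAEC2009, Prop. III.8.1] -/
theorem natCard_galoisCohomology_two_torsion_restrictField (F : Type u) [Field F] [Algebra K F] [CharZero F]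
    [ValuativeRel F] [TopologicalSpace F] [IsNonarchimedeanLocalField F]
    (n : ℕ) [NeZero n] (hn : IsPrimePow n) :
    Finite (galoisCohomology (GaloisRep.restrictField F (W.torsionGaloisModule n)) 2) ∧
    Nat.card (galoisCohomology (GaloisRep.restrictField F (W.torsionGaloisModule n)) 2) =
      Nat.card (nsmulAddMonoidHom n : (W.baseChange F).toAffine.Point →+ _).ker := by
  obtain ⟨p, k, hp, hk, hpk⟩ := hn
  haveI : Fact p.Prime := ⟨Nat.prime_iff.mpr hp⟩
  have h2 : 2 ≤ n := by
    rw [← hpk]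
    calc 2 ≤ p := (Fact.out : p.Prime).two_le
      _ = p ^ 1 := (pow_one p).symm
      _ ≤ p ^ k := Nat.pow_le_pow_right (Fact.out : p.Prime).pos hk
  haveI : PerfectField K := PerfectField.ofCharZero
  obtain ⟨e, hμ, hadd₁, hadd₂, -, hnondeg, hgal⟩ :=
    exists_weilPairing_holds W n h2 (by exact_mod_cast NeZero.ne n)
  set ρ : ContinuousRep (absoluteGaloisGroup F) ℤ (geomTorsion W n) :=
    GaloisRep.restrictField F (W.torsionGaloisModule n) with hρ
  have hM : ∀ m : geomTorsion W n, p ^ k • m = 0 := fun T => by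
    rw [hpk]; exact AddSubgroup.torsionBy.nsmul T
  obtain ⟨hfin, hcard⟩ := natCard_two_eq_natCard_invariants_homRep F ρ hM
  refine ⟨hfin, ?_⟩
  rw [hpk] at hcard
  change Nat.card (continuousCohomology 2 ρ.toTopRep) = _
  rw [hcard, ← natCard_invariants_torsion_restrictField W F (NeZero.ne n)]
  exact (Nat.card_congr (invariantsEquivOfIso
    (τ₁ := ρ) (τ₂ := ρ.homRep (mu F n))
    (weilDualLocalIso W n e hμ hadd₁ hadd₂ F hgal hnondeg))).symm

/-- **`#H¹(K_v, E[n]) = (#E(K_v)[n] · #(𝓞_v/n))²`** at a finite place `v` of a number field, for an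
elliptic curve `E = W` over `K` and a prime power `n`: Tate's local Euler–Poincaré characteristic
formula (Milne, *ADT*, I Thm. 2.8 — the named fact `localEulerPoincareCharacteristic K_v`) for
`M = E[n]` (`#M = n²`, so `(𝓞_v : n²𝓞_v) = #(𝓞_v/n)²`), with `#H⁰(K_v, E[n]) = #E(K_v)[n]`
(`natCard_invariants_torsion_restrictField`) and `#H²(K_v, E[n]) = #E(K_v)[n]`
(`natCard_galoisCohomology_two_torsion_restrictField`).  This is exactly the hypothesis `hEuler` of
`LocalTateDualityOrderForE.lean` and `CasselsTateLemma615LocalInputs.lean`.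
[cite: MilneADT2006, Ch. I §2, Thm. 2.8 and §3 Lemma 3.3] -/
theorem natCard_galoisCohomology_one_torsion_adicCompletion_eq_sq (n : ℕ) [NeZero n] (hn : IsPrimePow n)
    (hEP : localEulerPoincareCharacteristic (v.adicCompletion K)) :
    Nat.card (galoisCohomology
        (GaloisRep.restrictField (v.adicCompletion K) (W.torsionGaloisModule n)) 1) =
      (Nat.card (nsmulAddMonoidHom n :
            (W.baseChange (v.adicCompletion K)).toAffine.Point →+ _).ker *
          Nat.card (v.adicCompletionIntegers K ⧸
            Ideal.span {(n : v.adicCompletionIntegers K)})) ^ 2 := by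
  haveI : CharZero (v.adicCompletion K) := charZero_adicCompletion v
  set F := v.adicCompletion K with hF
  set ρ : ContinuousRep (absoluteGaloisGroup F) ℤ (geomTorsion W n) :=
    GaloisRep.restrictField F (W.torsionGaloisModule n) with hρ
  obtain ⟨-, -, hEq⟩ := hEP ρ
  -- `#E[n] = n²`
  have hMn : Nat.card (geomTorsion W n) = n * n := by
    rw [natCard_geomTorsion W (n : ℤ) (by exact_mod_cast NeZero.ne n), Int.natAbs_natCast, sq]
  -- `#H⁰` and `#H²`
  have h0 : Nat.card ρ.toTopRep.ρ.invariants =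
      Nat.card (nsmulAddMonoidHom n : (W.baseChange F).toAffine.Point →+ _).ker :=
    natCard_invariants_torsion_restrictField W F (NeZero.ne n)
  have h2 : Nat.card (continuousCohomology 2 ρ.toTopRep) =
      Nat.card (nsmulAddMonoidHom n : (W.baseChange F).toAffine.Point →+ _).ker :=
    (natCard_galoisCohomology_two_torsion_restrictField W F n hn).2
  -- `(𝒪 : n²𝒪) = #(𝓞_v/n)²`
  have hq : Nat.card (𝒪[F] ⧸ Ideal.span {((Nat.card (geomTorsion W n) : ℕ) : 𝒪[F])}) =
      Nat.card (v.adicCompletionIntegers K ⧸ Ideal.span {(n : v.adicCompletionIntegers K)}) ^ 2 := by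
    rw [hMn, natCard_integer_quotient_natCast_eq K v (n * n), Nat.cast_mul,
      natCard_quotient_span_singleton_mul (LocalPoints.natCast_ne_zero v (NeZero.ne n)), sq]
  change _ = Nat.card (continuousCohomology 1 ρ.toTopRep) at hEq
  change Nat.card (continuousCohomology 1 ρ.toTopRep) = _
  rw [← hEq, h0, h2, hq]
  ring

/-- **Tate local duality for `E`, order form, at prime-power level, from the local Euler–Poincaré
characteristic**: `#H¹(K_v, E)[n] = #E(K_v)[n] · #(𝓞_v/n)` (Milne, *ADT*, I Thm. 3.2 with
Lemma 3.3: `H¹(K, A)_n ≅ (A(K)/n)^*`, of order `#A(K)_n · (R : nR)`) — the tree's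
`natCard_torsionBy_galoisCohomology_localGaloisModule_eq_of_eulerChar` fed with
`natCard_galoisCohomology_one_torsion_adicCompletion_eq_sq`. [cite: MilneADT2006, Ch. I, Thm. 3.2 and Lemma 3.3] -/
theorem natCard_torsionBy_galoisCohomology_localGaloisModule_eq_of_localEuler (n : ℕ) [NeZero n]
    (hn : IsPrimePow n) (hEP : localEulerPoincareCharacteristic (v.adicCompletion K)) :
    Nat.card (AddSubgroup.torsionBy
          (galoisCohomology (W.localGaloisModule (v.adicCompletion K)) 1) (n : ℤ)) =
      Nat.card (nsmulAddMonoidHom n :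
            (W.baseChange (v.adicCompletion K)).toAffine.Point →+ _).ker *
        Nat.card (v.adicCompletionIntegers K ⧸
          Ideal.span {(n : v.adicCompletionIntegers K)}) :=
  natCard_torsionBy_galoisCohomology_localGaloisModule_eq_of_eulerChar W v (NeZero.ne n)
    (natCard_galoisCohomology_one_torsion_adicCompletion_eq_sq W v n hn hEP)

/-- The same with right-hand side `#(E(K_v)/nE(K_v))`: **`#H¹(K_v, E)[n] = #(E(K_v)/nE(K_v))`** for a
prime power `n` (the order statement of the perfect pairing `H¹(K_v, E)[n] × E(K_v)/n → ℚ/ℤ`).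
[cite: MilneADT2006, Ch. I, Thm. 3.2 and Cor. 3.4] -/
theorem natCard_torsionBy_galoisCohomology_localGaloisModule_eq_card_quotient_of_localEuler
    (n : ℕ) [NeZero n] (hn : IsPrimePow n)
    (hEP : localEulerPoincareCharacteristic (v.adicCompletion K)) :
    Nat.card (AddSubgroup.torsionBy
          (galoisCohomology (W.localGaloisModule (v.adicCompletion K)) 1) (n : ℤ)) =
      Nat.card ((W.baseChange (v.adicCompletion K)).toAffine.Point ⧸
        (nsmulAddMonoidHom n : (W.baseChange (v.adicCompletion K)).toAffine.Point →+ _).range) :=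
  natCard_torsionBy_galoisCohomology_localGaloisModule_eq_card_quotient_of_eulerChar W v (NeZero.ne n)
    (natCard_galoisCohomology_one_torsion_adicCompletion_eq_sq W v n hn hEP)

/-- **`𝓛_v^⊥ = 𝓛_v` at prime-power level from the local Euler–Poincaré characteristic**: for a
non-degenerate alternating `Γ_K`-equivariant `μₙ`-valued `e` on `E[n]` (a Weil pairing), `n` a prime
power, and `x ∈ H¹(K_v, E[n])`: `(∀ y ∈ 𝓛_v, x ∪ₑ y = 0) ↔ x ∈ 𝓛_v` — the local Kummer condition is
its own annihilator (Tate local duality for `E`, Milne I Cor. 3.4 / the local input of Lemma 6.15;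
Poonen–Rains Prop. 4.10); the tree's `…_iff_of_eulerChar` fed with this file's count.
[cite: MilneADT2006, Ch. I, Cor. 3.4 and Lemma 6.15] [cite: PoonenRains2012, Prop. 4.10] -/
theorem forall_mem_kummerLocalConditionAt_weilCupProduct_eq_zero_iff_of_localEuler (n : ℕ) [NeZero n]
    (hn : IsPrimePow n) (hEP : localEulerPoincareCharacteristic (v.adicCompletion K))
    (e : geomTorsion W n → geomTorsion W n → AlgebraicClosure K)
    (hμ : ∀ S T, e S T ^ n = 1)
    (hadd₁ : ∀ S₁ S₂ T, e (S₁ + S₂) T = e S₁ T * e S₂ T)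
    (hadd₂ : ∀ S T₁ T₂, e S (T₁ + T₂) = e S T₁ * e S T₂)
    (hgal : ∀ (σ : absoluteGaloisGroup K) (S T : geomTorsion W n), σ • e S T = e (σ • S) (σ • T))
    (halt : ∀ T, e T T = 1) (hnondeg : ∀ T, (∀ S, e S T = 1) → T = 0)
    (x : galoisCohomology (GaloisRep.restrictField (v.adicCompletion K) (W.torsionGaloisModule n)) 1) :
    (∀ y ∈ W.kummerLocalConditionAt n (v.adicCompletion K),
        ((weilContPairing W n e hμ hadd₁ hadd₂ hgal).restrict
          (absGaloisRestrict K (v.adicCompletion K))).cupProduct x y = 0) ↔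
      x ∈ W.kummerLocalConditionAt n (v.adicCompletion K) :=
  forall_mem_kummerLocalConditionAt_weilCupProduct_eq_zero_iff_of_eulerChar W v n e hμ hadd₁ hadd₂ hgal
    halt hnondeg (natCard_galoisCohomology_one_torsion_adicCompletion_eq_sq W v n hn hEP) x

end Torsion

end Literature.NumberTheory.EllipticCurves
end
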